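import Literature.GroupTheory.CombinatorialGroupTheory.RandomSclFreeGroupProofs
import HarnessLib

/-!
# Random rigidity of scl (Calegari–Walker 2013): proofs, part 4 — distinct subwords (Prop. 2.11)

D. Calegari, A. Walker, *Random rigidity in the free group*, Geom. Topol. 17 (2013)
[CalegariWalker2013], §2.5, Prop. 2.11: for `L > 1` the set `S` of subwords of length `Lm` of a
random reduced word `v` of length `n` has `n − card S` small with overwhelming probability ("it is
important for applications to show that the cardinality of `S` is very close to `n`").

We prove a FINITE FORM by the method of Prop. 2.6/Lemma 2.10, in a slightly more uniform way than
the printed proof: a position `J` whose window `w[J, J+ℓ]` repeats an EARLIER window (overlapping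
or not) is a position whose window lies in a set of at most `n` "dangerous" values determined by
the letters before `J` — the complete earlier windows, and the periodic extensions of the last
`d ≤ ℓ` letters (an overlapping repeat at distance `d` forces period `d`; this replaces the
"big/little overlaps" count of the printed proof). Hence:

* **`card_filter_windowHits_ge_le`** — the adapted Chernoff bound for the number of windows at
  positions `s 0 < s 1 < …` falling in prefix-determined sets of size `≤ M`
  (`p = M (2k−1)^{−(ℓ+1)}`); this generalises `card_filter_inverseRepeatCount_ge_le`.
* **`card_range_filter_le_sum_residue`** — residue-class decomposition of a count over positions.
* **`card_sub_card_image_le_card_repeats`** — `(n − ℓ) − #{distinct windows} ≤ #{repeating positions}`.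
* **`card_filter_fewDistinctWindows_le`** — Prop. 2.11, finite form: the number of reduced words of
  length `n` with `(n − ℓ) − card S ≥ (ℓ+1) a` is at most
  `(ℓ+1) |F_n| exp((n/(ℓ+1)) · n (2k−1)^{−(ℓ+1)} · (e^λ − 1) − λ a)` for every `λ ≥ 0`.
-/

noncomputable section

open Filter

namespace Literature.GroupTheory.CombinatorialGroupTheory

section WindowHits

open scoped Classical
open Literature.Probability.Moments

/-- **Lemma 2.10, general union form.** Conditional on a reduced past of length `i + 1`, the
window of length `ℓ + 1` right after it lies in a fixed set `D` of words for at most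
`card D · (2k−1)^{n−(i+1)−(ℓ+1)}` of the `(2k−1)^{n−(i+1)}` continuations.
[cite: CalegariWalker2013, Lemma 2.10] -/
theorem card_filter_prefix_windowMem_le (k i ℓ n : ℕ) (h : i + 1 + (ℓ + 1) ≤ n)
    (v : Fin (i + 1) → Fin k × Bool) (D : Finset (Fin (ℓ + 1) → Fin k × Bool)) :
    (((reducedWords k n).filter fun w => ∀ j : Fin (i + 1), w ⟨j, by omega⟩ = v j).filter
        fun w => (fun q : Fin (ℓ + 1) => w ⟨i + 1 + q, by omega⟩) ∈ D).card ≤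
      D.card * (2 * k - 1) ^ (n - (i + 1) - (ℓ + 1)) := by
  have hsub : (((reducedWords k n).filter fun w => ∀ j : Fin (i + 1), w ⟨j, by omega⟩ = v j).filter
        fun w => (fun q : Fin (ℓ + 1) => w ⟨i + 1 + q, by omega⟩) ∈ D) ⊆
      D.biUnion fun x => (reducedWords k n).filter fun w =>
        (∀ j : Fin (i + 1), w ⟨j, by omega⟩ = v j) ∧
          ∀ q : Fin (ℓ + 1), w ⟨i + 1 + q, by omega⟩ = x q := by
    intro w hw
    rw [Finset.mem_filter, Finset.mem_filter] at hw
    obtain ⟨⟨hwred, hwv⟩, hD⟩ := hw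
    rw [Finset.mem_biUnion]
    refine ⟨_, hD, ?_⟩
    rw [Finset.mem_filter]
    exact ⟨hwred, hwv, fun q => rfl⟩
  refine (Finset.card_le_card hsub).trans (Finset.card_biUnion_le.trans ?_)
  refine (Finset.sum_le_sum fun x _ => card_filter_prefix_window_le k i ℓ n h v x).trans ?_
  rw [Finset.sum_const, smul_eq_mul]

/-- **Adapted Chernoff bound for window hits (finite form of the method of Prop. 2.6/2.11).**
Let `k ≥ 1`, windows of length `ℓ + 1` at positions `s 0 ≥ 1`, `s t + (ℓ+1) ≤ s u` (`t < u`),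
`s t + (ℓ+1) ≤ n` (`t < T`), and for each `t` a set `D t w` of "dangerous" words determined by
the letters of `w` before position `s t`, of size at most `M` on reduced words. Then for `λ ≥ 0`
and any `a`, the reduced words with at least `a` indices `t < T` whose window `w[s t, s t + ℓ]`
lies in `D t w` number at most `|F_n| · exp(T p (e^λ − 1) − λ a)`, `p = M (2k−1)^{−(ℓ+1)}`.
[cite: CalegariWalker2013, Lemma 2.10 and proof of Prop. 2.6] -/
theorem card_filter_windowHits_ge_le (k n ℓ T M : ℕ) (hk : 1 ≤ k) (s : ℕ → ℕ)
    (hs0 : 1 ≤ s 0) (hs : ∀ t u, t < u → s t + (ℓ + 1) ≤ s u)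
    (hsn : ∀ t, t < T → s t + (ℓ + 1) ≤ n)
    (D : ℕ → (Fin n → Fin k × Bool) → Finset (Fin (ℓ + 1) → Fin k × Bool))
    (hD : ∀ t (w w' : Fin n → Fin k × Bool), (∀ q : Fin n, (q : ℕ) < s t → w q = w' q) →
      D t w = D t w')
    (hM : ∀ t w, t < T → w ∈ reducedWords k n → (D t w).card ≤ M)
    {l : ℝ} (hl : 0 ≤ l) (a : ℝ) :
    (((reducedWords k n).filter fun w => a ≤
        ∑ t : Fin T, if (fun q : Fin (ℓ + 1) => w ⟨s t + q, by have := hsn t t.isLt; omega⟩) ∈ D t w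
          then (1 : ℝ) else 0).card : ℝ) ≤
      (reducedWords k n).card *
        Real.exp (T * ((M : ℝ) / (2 * k - 1 : ℝ) ^ (ℓ + 1)) * (Real.exp l - 1) - l * a) := by
  set p : ℝ := (M : ℝ) / (2 * k - 1 : ℝ) ^ (ℓ + 1) with hpdef
  have hq1 : (1 : ℝ) ≤ 2 * k - 1 := by
    have : (1 : ℝ) ≤ k := by exact_mod_cast hk
    linarith
  have hqpos : (0 : ℝ) < (2 * k - 1 : ℝ) ^ (ℓ + 1) := by positivity
  have hp : 0 ≤ p := by rw [hpdef]; positivity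
  -- monotonicity of the positions
  have hsmono : ∀ t u, t ≤ u → s t ≤ s u := by
    intro t u htu
    rcases Nat.eq_or_lt_of_le htu with rfl | hlt
    · exact le_rfl
    · have := hs t u hlt; omega
  have hs1 : ∀ t, 1 ≤ s t := fun t => hs0.trans (hsmono 0 t (Nat.zero_le t))
  -- events and keys
  let X : ℕ → (Fin n → Fin k × Bool) → Prop := fun t w =>
    ∃ ht : t < T, (fun q : Fin (ℓ + 1) => w ⟨s t + q, by have := hsn t ht; omega⟩) ∈ D t w
  let key : ∀ _ : ℕ, (Fin n → Fin k × Bool) → (Fin n → Option (Fin k × Bool)) := fun t w q =>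
    if (q : ℕ) < s t then some (w q) else none
  have hkey0 : ∀ t w w', key t w = key t w' → ∀ q : Fin n, (q : ℕ) < s t → w q = w' q := by
    intro t w w' hww' q hq
    have := congrFun hww' q
    simp only [key, if_pos hq, Option.some.injEq] at this
    exact this
  have hkey : ∀ t, ∀ w ∈ reducedWords k n, ∀ w' ∈ reducedWords k n, key t w = key t w' →
      ∀ u < t, (X u w ↔ X u w') := by
    intro t w _ w' _ hww' u hut
    have hagree := hkey0 t w w' hww'
    have hsu := hs u t hut
    have hDu : D u w = D u w' := hD u w w' fun q hq => hagree q (by omega)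
    have hwin : ∀ hu : u < T,
        (fun q : Fin (ℓ + 1) => w ⟨s u + q, by have := hsn u hu; omega⟩) =
          fun q : Fin (ℓ + 1) => w' ⟨s u + q, by have := hsn u hu; omega⟩ := by
      intro hu
      funext q
      exact hagree _ (by simp; omega)
    constructor
    · rintro ⟨hu, hw⟩
      refine ⟨hu, ?_⟩
      rw [← hDu, ← hwin hu]
      exact hw
    · rintro ⟨hu, hw⟩
      refine ⟨hu, ?_⟩
      rw [hDu, hwin hu]
      exact hw
  -- conditional bound on each fibre
  have hX : ∀ t < T, ∀ v ∈ (reducedWords k n).image (key t),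
      (((((reducedWords k n).filter fun w => key t w = v).filter (X t)).card : ℝ)) ≤
        p * (((reducedWords k n).filter fun w => key t w = v).card : ℝ) := by
    intro t ht v hv
    obtain ⟨w₀, hw₀, rfl⟩ := Finset.mem_image.mp hv
    obtain ⟨i, hi⟩ : ∃ i, s t = i + 1 := ⟨s t - 1, by have := hs1 t; omega⟩
    have hstn : i + 1 + (ℓ + 1) ≤ n := by have := hsn t ht; omega
    set v' : Fin (i + 1) → Fin k × Bool := fun q => w₀ ⟨q, by omega⟩ with hv'
    have hv'red : v' ∈ reducedWords k (i + 1) := prefix_mem_reducedWords (by omega) hw₀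
    have hfib : ((reducedWords k n).filter fun w => key t w = key t w₀) =
        (reducedWords k n).filter fun w => ∀ q : Fin (i + 1), w ⟨q, by omega⟩ = v' q := by
      refine Finset.filter_congr fun w _ => ?_
      constructor
      · intro h' q
        exact hkey0 t w w₀ h' ⟨q, by omega⟩ (by simp; omega)
      · intro h'
        funext q
        show (if (q : ℕ) < s t then some (w q) else none) =
          (if (q : ℕ) < s t then some (w₀ q) else none)
        by_cases hq : (q : ℕ) < s t
        · rw [if_pos hq, if_pos hq, h' ⟨q, by omega⟩]
        · rw [if_neg hq, if_neg hq]
    -- on the fibre, `D t w = D t w₀`, so the event is "window ∈ D t w₀"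
    have hev : (((reducedWords k n).filter fun w => key t w = key t w₀).filter (X t)) ⊆
        ((reducedWords k n).filter fun w => ∀ j : Fin (i + 1), w ⟨j, by omega⟩ = v' j).filter
          fun w => (fun q : Fin (ℓ + 1) => w ⟨i + 1 + q, by omega⟩) ∈ D t w₀ := by
      intro w hw
      rw [Finset.mem_filter] at hw ⊢
      obtain ⟨hwfib, _, hwin⟩ := hw
      have hwfib' := hwfib
      rw [hfib] at hwfib'
      refine ⟨hwfib', ?_⟩
      have hDt : D t w = D t w₀ :=
        hD t w w₀ fun q hq => hkey0 t w w₀ (Finset.mem_filter.mp hwfib).2 q hq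
      have e1 : (fun q : Fin (ℓ + 1) => w ⟨i + 1 + q, by omega⟩) =
          fun q : Fin (ℓ + 1) => w ⟨s t + q, by have := hsn t ht; omega⟩ := by
        funext q
        exact congrArg w (Fin.ext (show i + 1 + (q : ℕ) = s t + q by omega))
      rw [e1, ← hDt]
      exact hwin
    have hcard := (Finset.card_le_card hev).trans
      (card_filter_prefix_windowMem_le k i ℓ n hstn v' (D t w₀))
    have hMt := hM t w₀ ht hw₀
    have hcardR : ((((reducedWords k n).filter fun w => key t w = key t w₀).filter
        (X t)).card : ℝ) ≤ (M : ℝ) * (2 * k - 1 : ℝ) ^ (n - (i + 1) - (ℓ + 1)) := by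
      have h'' : ((((reducedWords k n).filter fun w => key t w = key t w₀).filter
          (X t)).card : ℝ) ≤ (((D t w₀).card * (2 * k - 1) ^ (n - (i + 1) - (ℓ + 1)) : ℕ) : ℝ) := by
        exact_mod_cast hcard
      refine h''.trans ?_
      push_cast [Nat.cast_sub (show 1 ≤ 2 * k by omega)]
      exact mul_le_mul_of_nonneg_right (by exact_mod_cast hMt) (by positivity)
    refine hcardR.trans ?_
    rw [hfib, card_filter_prefix' k i n (by omega) v' hv'red]
    have hpow : (2 * k - 1 : ℝ) ^ (n - (i + 1) - (ℓ + 1)) * (2 * k - 1 : ℝ) ^ (ℓ + 1) =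
        (2 * k - 1 : ℝ) ^ (n - (i + 1)) := by
      rw [← pow_add, show n - (i + 1) - (ℓ + 1) + (ℓ + 1) = n - (i + 1) by omega]
    rw [hpdef]
    push_cast [Nat.cast_sub (show 1 ≤ 2 * k by omega)]
    rw [div_mul_eq_mul_div, le_div_iff₀ hqpos, mul_assoc, hpow]
  -- the adapted Chernoff bound, free `λ`
  have hmain := card_filter_sum_indicator_ge_le (reducedWords k n) key X hp hkey T hX hl a
  -- identify the sums
  have hsum : ∀ w : Fin n → Fin k × Bool,
      (∑ t ∈ Finset.range T, if X t w then (1 : ℝ) else 0) =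
        ∑ t : Fin T, if (fun q : Fin (ℓ + 1) => w ⟨s t + q, by have := hsn t t.isLt; omega⟩) ∈
          D t w then (1 : ℝ) else 0 := by
    intro w
    rw [Finset.sum_range]
    refine Finset.sum_congr rfl fun t _ => ?_
    have hiff : X t w ↔ (fun q : Fin (ℓ + 1) => w ⟨s t + q, by have := hsn t t.isLt; omega⟩) ∈
        D t w := ⟨fun ⟨_, h'⟩ => h', fun h' => ⟨t.isLt, h'⟩⟩
    by_cases hXt : X t w
    · rw [if_pos hXt, if_pos (hiff.mp hXt)]
    · rw [if_neg hXt, if_neg (fun h' => hXt (hiff.mpr h'))]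
  have hfilter : ((reducedWords k n).filter fun w => a ≤
      ∑ t ∈ Finset.range T, if X t w then (1 : ℝ) else 0) =
      (reducedWords k n).filter fun w => a ≤
        ∑ t : Fin T, if (fun q : Fin (ℓ + 1) => w ⟨s t + q, by have := hsn t t.isLt; omega⟩) ∈
          D t w then (1 : ℝ) else 0 :=
    Finset.filter_congr fun w _ => by rw [hsum w]
  rw [hfilter] at hmain
  rw [hpdef] at hmain
  exact hmain

end WindowHits

section Residues

open scoped Classical

/-- Positions along the residue class `j`: `j + 1 + t (ℓ+1)` is a legal window start for
`t < (n − (j+1)) / (ℓ+1)`. [folklore] -/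
theorem residue_position_le {n ℓ j : ℕ} (t : Fin ((n - (j + 1)) / (ℓ + 1))) :
    j + 1 + (t : ℕ) * (ℓ + 1) + (ℓ + 1) ≤ n := by
  have h1 : (t : ℕ) + 1 ≤ (n - (j + 1)) / (ℓ + 1) := Nat.succ_le_of_lt t.isLt
  have h2 := (Nat.le_div_iff_mul_le (show 0 < ℓ + 1 by omega)).mp h1
  rw [add_mul, one_mul] at h2
  omega

/-- **Residue-class decomposition of a count over positions.** For any property `E` of positions
holding only at positions `≥ 1`, the number of positions `J < n − ℓ` with `E J` is at most the sum
over `j < ℓ + 1` of the counts along `J = j + 1 + t(ℓ+1)`, `t < (n − (j+1))/(ℓ+1)`. [folklore] -/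
theorem card_range_filter_le_sum_residue (n ℓ : ℕ) (E : ℕ → Prop) [DecidablePred E]
    (hE : ∀ J, E J → 1 ≤ J) :
    ((((Finset.range (n - ℓ)).filter E).card : ℕ) : ℝ) ≤
      ∑ j ∈ Finset.range (ℓ + 1), ∑ t : Fin ((n - (j + 1)) / (ℓ + 1)),
        if E (j + 1 + (t : ℕ) * (ℓ + 1)) then (1 : ℝ) else 0 := by
  have hrhs : ∀ j ∈ Finset.range (ℓ + 1),
      (∑ t : Fin ((n - (j + 1)) / (ℓ + 1)), if E (j + 1 + (t : ℕ) * (ℓ + 1)) then (1 : ℝ) else 0) =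
        ((Finset.univ.filter fun t : Fin ((n - (j + 1)) / (ℓ + 1)) =>
          E (j + 1 + (t : ℕ) * (ℓ + 1))).card : ℝ) := by
    intro j _
    rw [Finset.sum_boole]
  rw [Finset.sum_congr rfl hrhs]
  have hfib := Finset.card_eq_sum_card_fiberwise (s := (Finset.range (n - ℓ)).filter E)
    (t := Finset.range (ℓ + 1)) (f := fun J : ℕ => (J - 1) % (ℓ + 1))
    (fun J _ => Finset.mem_range.mpr (Nat.mod_lt _ (Nat.succ_pos ℓ)))
  have hle : ∀ j ∈ Finset.range (ℓ + 1),
      (((Finset.range (n - ℓ)).filter E).filter fun J : ℕ => (J - 1) % (ℓ + 1) = j).card ≤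
        (Finset.univ.filter fun t : Fin ((n - (j + 1)) / (ℓ + 1)) =>
          E (j + 1 + (t : ℕ) * (ℓ + 1))).card := by
    intro j hj
    have hsub : (((Finset.range (n - ℓ)).filter E).filter fun J : ℕ => (J - 1) % (ℓ + 1) = j) ⊆
        (Finset.univ.filter fun t : Fin ((n - (j + 1)) / (ℓ + 1)) =>
          E (j + 1 + (t : ℕ) * (ℓ + 1))).image fun t : Fin ((n - (j + 1)) / (ℓ + 1)) =>
            j + 1 + (t : ℕ) * (ℓ + 1) := by
      intro J hJ
      rw [Finset.mem_filter, Finset.mem_filter, Finset.mem_range] at hJ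
      obtain ⟨⟨hJlt, hEJ⟩, hres⟩ := hJ
      have hJ1 := hE J hEJ
      have hdm : (J - 1) / (ℓ + 1) * (ℓ + 1) + j = J - 1 := by
        rw [Nat.mul_comm, ← hres]
        exact Nat.div_add_mod _ _
      have htlt : (J - 1) / (ℓ + 1) < (n - (j + 1)) / (ℓ + 1) := by
        refine Nat.lt_of_succ_le ((Nat.le_div_iff_mul_le (show 0 < ℓ + 1 by omega)).mpr ?_)
        rw [Nat.succ_mul]
        omega
      have hpos : j + 1 + (J - 1) / (ℓ + 1) * (ℓ + 1) = J := by omega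
      rw [Finset.mem_image]
      refine ⟨⟨(J - 1) / (ℓ + 1), htlt⟩, ?_, hpos⟩
      rw [Finset.mem_filter]
      exact ⟨Finset.mem_univ _, by rw [hpos]; exact hEJ⟩
    exact (Finset.card_le_card hsub).trans Finset.card_image_le
  rw [hfib]
  push_cast
  exact Finset.sum_le_sum fun j hj => by exact_mod_cast hle j hj

end Residues

section DistinctWindows

open scoped Classical
open Literature.Probability.Moments

/-- **Domain minus image ≤ repeats.** For any map `f : Fin N → β`, the number of indices `J`
repeating an earlier value (`f i' = f J` for some `i' < J`) is at least `N − #(image of f)`.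
[folklore] -/
theorem card_sub_card_image_le_card_repeats {β : Type*} [DecidableEq β] {N : ℕ}
    (f : Fin N → β) :
    N - (Finset.univ.image f).card ≤
      ((Finset.univ : Finset (Fin N)).filter fun J : Fin N => ∃ i' : Fin N, i' < J ∧ f i' = f J).card := by
  -- the first occurrences inject into the image
  set R := (Finset.univ : Finset (Fin N)).filter fun J : Fin N => ∃ i' : Fin N, i' < J ∧ f i' = f J
    with hR
  have hinj : (Finset.univ \ R).card ≤ (Finset.univ.image f).card := by
    refine Finset.card_le_card_of_injOn f (fun J _ => Finset.mem_image_of_mem f (Finset.mem_univ _))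
      ?_
    intro J₁ hJ₁ J₂ hJ₂ hf
    rw [Finset.coe_sdiff, Set.mem_sdiff] at hJ₁ hJ₂
    have h1 : J₁ ∉ R := fun h => hJ₁.2 h
    have h2 : J₂ ∉ R := fun h => hJ₂.2 h
    rw [hR, Finset.mem_filter, not_and] at h1 h2
    have h1' := h1 (Finset.mem_univ _)
    have h2' := h2 (Finset.mem_univ _)
    by_contra hne
    rcases lt_or_gt_of_ne hne with hlt | hlt
    · exact h2' ⟨J₁, hlt, hf⟩
    · exact h1' ⟨J₂, hlt, hf.symm⟩
  have hsd : (Finset.univ \ R).card = N - R.card := by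
    rw [Finset.card_sdiff_of_subset (Finset.subset_univ R), Finset.card_univ, Fintype.card_fin]
  have hRle : R.card ≤ N := by
    simpa using Finset.card_le_univ R
  omega

/-- **A repeat of an earlier window is a hit of a prefix-determined set of size `≤ n`.** If the
window `w[J, J+ℓ]` equals the window at an earlier position `i' < J`, then either `i' + ℓ + 1 ≤ J`
(a complete earlier window) or, with `d = J − i' ≤ ℓ`, the block `w[i', J+ℓ]` has period `d`, so
that `w (J + q) = w (J − d + (q mod d))`: the window is the period-`d` extension of the `d`
letters before it. [cite: CalegariWalker2013, proof of Prop. 2.11] -/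
theorem window_eq_periodicExtension {α : Type*} {n ℓ J i' : ℕ} (w : Fin n → α)
    (hJ : J + ℓ + 1 ≤ n) (hi' : i' < J) (hd : J ≤ i' + ℓ)
    (h : ∀ q : Fin (ℓ + 1), w ⟨i' + q, by omega⟩ = w ⟨J + q, by omega⟩) :
    ∀ q : Fin (ℓ + 1), w ⟨J + q, by omega⟩ =
      w ⟨J - (J - i') + ((q : ℕ) % (J - i')), by
        have := Nat.mod_lt (q : ℕ) (show 0 < J - i' by omega); omega⟩ := by
  have hdpos : 0 < J - i' := by omega
  -- periodicity: `w (J + r) = w (J + r - d)` for `r ≤ ℓ`… iterate on the quotient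
  have hper : ∀ r : ℕ, ∀ hr : r ≤ ℓ, w ⟨J + r, by omega⟩ = w ⟨i' + r, by omega⟩ :=
    fun r hr => (h ⟨r, by omega⟩).symm
  intro q
  -- strong induction on `q`
  have key : ∀ (m : ℕ) (hm : m ≤ ℓ), w ⟨J + m, by omega⟩ =
      w ⟨J - (J - i') + (m % (J - i')), by
        have := Nat.mod_lt m hdpos; omega⟩ := by
    intro m
    induction m using Nat.strong_induction_on with
    | _ m ih =>
      intro hm
      by_cases hlt : m < J - i'
      · rw [hper m hm]
        exact congrArg w (Fin.ext (by
          simp only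
          rw [Nat.mod_eq_of_lt hlt]; omega))
      · have hm' : m - (J - i') < m := by omega
        have e1 : w ⟨J + m, by omega⟩ = w ⟨J + (m - (J - i')), by omega⟩ := by
          rw [hper m hm]
          exact congrArg w (Fin.ext (by simp only; omega))
        rw [e1, ih (m - (J - i')) hm' (by omega)]
        exact congrArg w (Fin.ext (by
          simp only
          rw [show m = (m - (J - i')) + (J - i') by omega, Nat.add_mod_right]
          simp))
  exact key q (by omega)

/-- **Calegari–Walker Prop. 2.11 (finite form).** For `k ≥ 1`, a window length `ℓ + 1`,
`λ ≥ 0` and any `a`: the number of reduced words `w` of length `n` for which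
`(n − ℓ) − card {windows of w of length ℓ+1} ≥ (ℓ+1)·a` is at most
`(ℓ+1) · |F_n| · exp((n/(ℓ+1)) · n(2k−1)^{−(ℓ+1)} · (e^λ − 1) − λ a)`.
(With `ℓ + 1 = Lm`, `L > 1`, `(ℓ+1) a = n^{1−ε}`, `λ = 1`: `Pr(n − card S > n^{1−ε}) = O(C^{−n^c})`.)
[cite: CalegariWalker2013, Prop. 2.11] -/
theorem card_filter_fewDistinctWindows_le (k n ℓ : ℕ) (hk : 1 ≤ k) {l : ℝ} (hl : 0 ≤ l) (a : ℝ) :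
    (((reducedWords k n).filter fun w => ((ℓ : ℝ) + 1) * a ≤
        (((n - ℓ : ℕ) : ℝ) - (((Finset.univ : Finset (Fin (n - ℓ))).image fun J : Fin (n - ℓ) =>
          fun q : Fin (ℓ + 1) => w ⟨J + q, by omega⟩).card : ℝ))).card : ℝ) ≤
      ((ℓ : ℝ) + 1) * (reducedWords k n).card *
        Real.exp ((n : ℝ) / ((ℓ : ℝ) + 1) * ((n : ℝ) / (2 * k - 1 : ℝ) ^ (ℓ + 1)) *
          (Real.exp l - 1) - l * a) := by
  have hq1 : (1 : ℝ) ≤ 2 * k - 1 := by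
    have : (1 : ℝ) ≤ k := by exact_mod_cast hk
    linarith
  have hel : 0 ≤ Real.exp l - 1 := by linarith [Real.add_one_le_exp l, Real.exp_pos l]
  have hp : (0 : ℝ) ≤ (n : ℝ) / (2 * k - 1 : ℝ) ^ (ℓ + 1) := by positivity
  -- degenerate case `n = 0`
  rcases Nat.eq_zero_or_pos n with hn0 | hn
  · subst hn0
    by_cases ha : 0 < a
    · have hempty : ((reducedWords k 0).filter fun w => ((ℓ : ℝ) + 1) * a ≤
          (((0 - ℓ : ℕ) : ℝ) - (((Finset.univ : Finset (Fin (0 - ℓ))).image fun J : Fin (0 - ℓ) =>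
            fun q : Fin (ℓ + 1) => w ⟨J + q, by omega⟩).card : ℝ))) = ∅ := by
        refine Finset.filter_eq_empty_iff.mpr fun w _ => ?_
        rw [not_le]
        have : (((0 - ℓ : ℕ) : ℝ)) = 0 := by simp
        rw [this]
        have hc : (0 : ℝ) ≤ (((Finset.univ : Finset (Fin (0 - ℓ))).image fun J : Fin (0 - ℓ) =>
            fun q : Fin (ℓ + 1) => w ⟨J + q, by omega⟩).card : ℝ) := Nat.cast_nonneg _
        nlinarith
      rw [hempty, Finset.card_empty, Nat.cast_zero]
      positivity
    · rw [not_lt] at ha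
      have hexp : 1 ≤ Real.exp (((0 : ℕ) : ℝ) / ((ℓ : ℝ) + 1) * (((0 : ℕ) : ℝ) / (2 * k - 1 : ℝ) ^ (ℓ + 1)) *
          (Real.exp l - 1) - l * a) := by
        rw [Nat.cast_zero, zero_div, zero_mul, zero_mul, zero_sub, Real.one_le_exp_iff]
        nlinarith
      have hcard : (((reducedWords k 0).filter fun w => ((ℓ : ℝ) + 1) * a ≤
          (((0 - ℓ : ℕ) : ℝ) - (((Finset.univ : Finset (Fin (0 - ℓ))).image fun J : Fin (0 - ℓ) =>
            fun q : Fin (ℓ + 1) => w ⟨J + q, by omega⟩).card : ℝ))).card : ℝ) ≤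
          (reducedWords k 0).card := by
        exact_mod_cast Finset.card_filter_le _ _
      have hF : (0 : ℝ) ≤ (reducedWords k 0).card := Nat.cast_nonneg _
      have hℓ : (0 : ℝ) ≤ ℓ := Nat.cast_nonneg _
      calc _ ≤ ((reducedWords k 0).card : ℝ) := hcard
        _ ≤ ((ℓ : ℝ) + 1) * (reducedWords k 0).card * 1 := by nlinarith
        _ ≤ _ := mul_le_mul_of_nonneg_left hexp (by positivity)
  -- the dangerous sets at position `J`: complete earlier windows and periodic extensions
  let Dpos : ℕ → (Fin n → Fin k × Bool) → Finset (Fin (ℓ + 1) → Fin k × Bool) := fun J w =>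
    ((Finset.range (J - ℓ)).image fun i' => fun q : Fin (ℓ + 1) =>
        if h : i' + (q : ℕ) < n then w ⟨i' + q, h⟩ else w ⟨0, hn⟩) ∪
      ((Finset.range (min ℓ J)).image fun d' => fun q : Fin (ℓ + 1) =>
        if h : J - (d' + 1) + ((q : ℕ) % (d' + 1)) < n then
          w ⟨J - (d' + 1) + ((q : ℕ) % (d' + 1)), h⟩ else w ⟨0, hn⟩)
  have hDdet : ∀ (J : ℕ), 1 ≤ J → ∀ (w w' : Fin n → Fin k × Bool),
      (∀ q : Fin n, (q : ℕ) < J → w q = w' q) → Dpos J w = Dpos J w' := by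
    intro J hJ w w' hww'
    simp only [Dpos]
    congr 1
    · refine Finset.image_congr fun i' hi' => ?_
      rw [Finset.mem_coe, Finset.mem_range] at hi'
      funext q
      split_ifs with h
      · exact hww' _ (by simp; omega)
      · exact hww' _ (by simp; omega)
    · refine Finset.image_congr fun d' hd' => ?_
      rw [Finset.mem_coe, Finset.mem_range, lt_min_iff] at hd'
      funext q
      split_ifs with h
      · exact hww' _ (by
          simp only
          have := Nat.mod_lt (q : ℕ) (show 0 < d' + 1 by omega); omega)
      · exact hww' _ (by simp; omega)
  have hDcard : ∀ (J : ℕ) (w : Fin n → Fin k × Bool), J ≤ n → (Dpos J w).card ≤ n := by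
    intro J w hJ
    refine (Finset.card_union_le _ _).trans ?_
    refine (add_le_add Finset.card_image_le Finset.card_image_le).trans ?_
    rw [Finset.card_range, Finset.card_range]
    have := min_le_right ℓ J
    have := min_le_left ℓ J
    omega
  -- Step B: a repeat of an earlier window is a hit of `Dpos`
  have hrep : ∀ (w : Fin n → Fin k × Bool) (J : Fin (n - ℓ)),
      (∃ i' : Fin (n - ℓ), i' < J ∧ (fun q : Fin (ℓ + 1) => w ⟨i' + q, by omega⟩) =
        fun q : Fin (ℓ + 1) => w ⟨J + q, by omega⟩) →
      (fun q : Fin (ℓ + 1) => w ⟨J + q, by omega⟩) ∈ Dpos J w := by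
    rintro w J ⟨i', hi'J, hwin⟩
    have hi'J' : (i' : ℕ) < J := hi'J
    simp only [Dpos, Finset.mem_union, Finset.mem_image, Finset.mem_range]
    by_cases hfar : (i' : ℕ) + ℓ + 1 ≤ J
    · left
      refine ⟨i', by omega, ?_⟩
      rw [← hwin]
      funext q
      rw [dif_pos (by omega)]
    · right
      rw [not_le] at hfar
      refine ⟨(J : ℕ) - i' - 1, by rw [lt_min_iff]; omega, ?_⟩
      have hper := window_eq_periodicExtension (ℓ := ℓ) (J := J) (i' := i') w (by omega) hi'J'
        (by omega) (fun q => congrFun hwin q)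
      funext q
      have hd : (J : ℕ) - i' - 1 + 1 = J - i' := by omega
      rw [hper q]
      simp only [hd]
      rw [dif_pos (by have := Nat.mod_lt (q : ℕ) (show 0 < (J : ℕ) - i' by omega); omega)]
  -- the hit-count property along residue class `j`, and the threshold property
  set C : ℕ → (Fin n → Fin k × Bool) → ℝ := fun j w => ∑ t : Fin ((n - (j + 1)) / (ℓ + 1)),
      if (fun q : Fin (ℓ + 1) => w ⟨j + 1 + (t : ℕ) * (ℓ + 1) + q, by
          have := residue_position_le t; omega⟩) ∈ Dpos (j + 1 + (t : ℕ) * (ℓ + 1)) w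
        then (1 : ℝ) else 0 with hC
  -- Step A + C: few distinct windows ⇒ many hits ⇒ some residue class has many hits
  have hsub : ((reducedWords k n).filter fun w => ((ℓ : ℝ) + 1) * a ≤
      (((n - ℓ : ℕ) : ℝ) - (((Finset.univ : Finset (Fin (n - ℓ))).image fun J : Fin (n - ℓ) =>
        fun q : Fin (ℓ + 1) => w ⟨J + q, by omega⟩).card : ℝ))) ⊆
      (Finset.range (ℓ + 1)).biUnion fun j => (reducedWords k n).filter fun w => a ≤ C j w := by
    intro w hw
    rw [Finset.mem_filter] at hw
    obtain ⟨hwred, hwa⟩ := hw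
    -- (n - ℓ) - #image ≤ #repeats
    have hA := card_sub_card_image_le_card_repeats
      (fun J : Fin (n - ℓ) => fun q : Fin (ℓ + 1) => w ⟨J + q, by omega⟩)
    -- repeats ⊆ hits, counted over `ℕ`-positions with the property `E`
    let E : ℕ → Prop := fun J => 1 ≤ J ∧ ∃ hJ : J < n - ℓ,
      (fun q : Fin (ℓ + 1) => w ⟨J + q, by omega⟩) ∈ Dpos J w
    have hE1 : ∀ J, E J → 1 ≤ J := fun J h => h.1
    have hB : ((Finset.univ : Finset (Fin (n - ℓ))).filter fun J : Fin (n - ℓ) =>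
        ∃ i' : Fin (n - ℓ), i' < J ∧ (fun q : Fin (ℓ + 1) => w ⟨i' + q, by omega⟩) =
          fun q : Fin (ℓ + 1) => w ⟨J + q, by omega⟩).card ≤
        ((Finset.range (n - ℓ)).filter E).card := by
      refine Finset.card_le_card_of_injOn (fun J => (J : ℕ)) ?_ ?_
      · intro J hJ
        rw [Finset.mem_coe, Finset.mem_filter] at hJ
        obtain ⟨_, i', hi', hwin'⟩ := hJ
        rw [Finset.mem_coe, Finset.mem_filter, Finset.mem_range]
        have hi'J : (i' : ℕ) < J := hi'
        have hJ1 : 1 ≤ (J : ℕ) := by omega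
        exact ⟨J.isLt, hJ1, J.isLt, hrep w J ⟨i', hi', hwin'⟩⟩
      · intro J₁ _ J₂ _ h
        exact Fin.ext h
    have hCres := card_range_filter_le_sum_residue n ℓ E hE1
    -- compare the residue sums of `E` with the hit counts `C j w`
    have hchain : ((((Finset.range (n - ℓ)).filter E).card : ℕ) : ℝ) ≤
        ∑ j ∈ Finset.range (ℓ + 1), C j w := by
      refine hCres.trans (Finset.sum_le_sum fun j _ => Finset.sum_le_sum fun t _ => ?_)
      by_cases hEt : E (j + 1 + (t : ℕ) * (ℓ + 1))
      · obtain ⟨_, _, hhit⟩ := hEt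
        rw [if_pos ⟨‹_›, ‹_›, hhit⟩, if_pos hhit]
      · rw [if_neg hEt]
        split_ifs <;> norm_num
    have htotal : ((ℓ : ℝ) + 1) * a ≤ ∑ j ∈ Finset.range (ℓ + 1), C j w := by
      have h1 : (((n - ℓ : ℕ) : ℝ) - (((Finset.univ : Finset (Fin (n - ℓ))).image
          fun J : Fin (n - ℓ) => fun q : Fin (ℓ + 1) => w ⟨J + q, by omega⟩).card : ℝ)) ≤
          ((((Finset.range (n - ℓ)).filter E).card : ℕ) : ℝ) := by
        have h := (Nat.cast_le (α := ℝ)).mpr (hA.trans hB)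
        refine le_trans ?_ h
        rw [sub_le_iff_le_add]
        exact_mod_cast le_tsub_add
      linarith
    rw [Finset.mem_biUnion]
    by_contra hcon
    have hlt : ∀ j ∈ Finset.range (ℓ + 1), C j w < a := fun j hj =>
      lt_of_not_ge fun hge => hcon ⟨j, hj, Finset.mem_filter.mpr ⟨hwred, hge⟩⟩
    have hsum : ∑ j ∈ Finset.range (ℓ + 1), C j w < ∑ _j ∈ Finset.range (ℓ + 1), a :=
      Finset.sum_lt_sum_of_nonempty ⟨0, by simp⟩ hlt
    rw [Finset.sum_const, Finset.card_range, nsmul_eq_mul] at hsum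
    push_cast at hsum
    linarith
  have hcard1 := (Finset.card_le_card hsub).trans Finset.card_biUnion_le
  have hcard1' := (Nat.cast_le (α := ℝ)).mpr hcard1
  rw [Nat.cast_sum] at hcard1'
  refine hcard1'.trans ?_
  -- Step D: each residue class by the adapted Chernoff bound for window hits
  have hclass : ∀ j ∈ Finset.range (ℓ + 1),
      (((reducedWords k n).filter fun w => a ≤ C j w).card : ℝ) ≤
        (reducedWords k n).card * Real.exp ((n : ℝ) / ((ℓ : ℝ) + 1) *
          ((n : ℝ) / (2 * k - 1 : ℝ) ^ (ℓ + 1)) * (Real.exp l - 1) - l * a) := by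
    intro j _
    have hs0 : 1 ≤ (fun t : ℕ => j + 1 + t * (ℓ + 1)) 0 := by
      show 1 ≤ j + 1 + 0 * (ℓ + 1)
      omega
    have hs : ∀ t u : ℕ, t < u → (fun t : ℕ => j + 1 + t * (ℓ + 1)) t + (ℓ + 1) ≤
        (fun t : ℕ => j + 1 + t * (ℓ + 1)) u := by
      intro t u htu
      show j + 1 + t * (ℓ + 1) + (ℓ + 1) ≤ j + 1 + u * (ℓ + 1)
      have := Nat.mul_le_mul_right (ℓ + 1) (Nat.succ_le_of_lt htu)
      rw [Nat.succ_mul] at this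
      omega
    have hsn : ∀ t : ℕ, t < (n - (j + 1)) / (ℓ + 1) →
        (fun t : ℕ => j + 1 + t * (ℓ + 1)) t + (ℓ + 1) ≤ n := by
      intro t ht
      exact residue_position_le (⟨t, ht⟩ : Fin ((n - (j + 1)) / (ℓ + 1)))
    have hB := card_filter_windowHits_ge_le k n ℓ ((n - (j + 1)) / (ℓ + 1)) n hk
      (fun t : ℕ => j + 1 + t * (ℓ + 1)) hs0 hs hsn
      (fun t w => Dpos (j + 1 + t * (ℓ + 1)) w)
      (fun t w w' hww' => hDdet _ (by omega) w w' hww')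
      (fun t w ht _ => hDcard _ w (by
        have h : j + 1 + t * (ℓ + 1) + (ℓ + 1) ≤ n :=
          residue_position_le (⟨t, ht⟩ : Fin ((n - (j + 1)) / (ℓ + 1)))
        omega)) hl a
    refine hB.trans (mul_le_mul_of_nonneg_left (Real.exp_le_exp.mpr ?_) (Nat.cast_nonneg _))
    have hT : (((n - (j + 1)) / (ℓ + 1) : ℕ) : ℝ) ≤ (n : ℝ) / ((ℓ : ℝ) + 1) := by
      refine (Nat.cast_div_le).trans ?_
      push_cast
      exact div_le_div_of_nonneg_right (by exact_mod_cast Nat.sub_le n (j + 1)) (by positivity)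
    have := mul_le_mul_of_nonneg_right hT (mul_nonneg hp hel)
    nlinarith
  calc ∑ j ∈ Finset.range (ℓ + 1), (((reducedWords k n).filter fun w => a ≤ C j w).card : ℝ)
      ≤ ∑ _j ∈ Finset.range (ℓ + 1), (reducedWords k n).card * Real.exp ((n : ℝ) / ((ℓ : ℝ) + 1) *
          ((n : ℝ) / (2 * k - 1 : ℝ) ^ (ℓ + 1)) * (Real.exp l - 1) - l * a) :=
        Finset.sum_le_sum hclass
    _ = ((ℓ : ℝ) + 1) * (reducedWords k n).card *
        Real.exp ((n : ℝ) / ((ℓ : ℝ) + 1) * ((n : ℝ) / (2 * k - 1 : ℝ) ^ (ℓ + 1)) *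
          (Real.exp l - 1) - l * a) := by
        rw [Finset.sum_const, Finset.card_range, nsmul_eq_mul]
        push_cast
        ring

/-- **Repeats ≤ domain minus image.** For any map `f : Fin N → β`, the indices `J` repeating an
earlier value number at most `N − #(image of f)` (the first occurrences are in bijection with the
image); together with `card_sub_card_image_le_card_repeats` this is an equality. [folklore] -/
theorem card_repeats_le_sub_card_image {β : Type*} [DecidableEq β] {N : ℕ} (f : Fin N → β) :
    ((Finset.univ : Finset (Fin N)).filter fun J : Fin N => ∃ i' : Fin N, i' < J ∧ f i' = f J).card ≤
      N - (Finset.univ.image f).card := by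
  set R := (Finset.univ : Finset (Fin N)).filter fun J : Fin N => ∃ i' : Fin N, i' < J ∧ f i' = f J
    with hR
  -- every value has a first occurrence, which is not a repeat
  have himg : (Finset.univ.image f).card ≤ (Finset.univ \ R).card := by
    have hsub : Finset.univ.image f ⊆ (Finset.univ \ R).image f := by
      intro y hy
      rw [Finset.mem_image] at hy
      obtain ⟨J, _, rfl⟩ := hy
      have hne : (Finset.univ.filter fun J' : Fin N => f J' = f J).Nonempty :=
        ⟨J, Finset.mem_filter.mpr ⟨Finset.mem_univ _, rfl⟩⟩
      set J₀ := (Finset.univ.filter fun J' : Fin N => f J' = f J).min' hne with hJ₀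
      have hJ₀f : f J₀ = f J := (Finset.mem_filter.mp (Finset.min'_mem _ hne)).2
      rw [Finset.mem_image]
      refine ⟨J₀, ?_, hJ₀f⟩
      rw [Finset.mem_sdiff]
      refine ⟨Finset.mem_univ _, ?_⟩
      rw [hR, Finset.mem_filter, not_and]
      intro _
      rintro ⟨i', hi', hfi'⟩
      have hmem : i' ∈ (Finset.univ.filter fun J' : Fin N => f J' = f J) :=
        Finset.mem_filter.mpr ⟨Finset.mem_univ _, by rw [hfi', hJ₀f]⟩
      exact absurd (Finset.min'_le _ i' hmem) (not_le.mpr hi')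
    exact (Finset.card_le_card hsub).trans Finset.card_image_le
  have hsd : (Finset.univ \ R).card = N - R.card := by
    rw [Finset.card_sdiff_of_subset (Finset.subset_univ R), Finset.card_univ, Fintype.card_fin]
  have hRle : R.card ≤ N := by simpa using Finset.card_le_univ R
  omega

/-- **Calegari–Walker Prop. 2.11, repeats form (finite).** For `k ≥ 1`, a window length `ℓ + 1`,
`λ ≥ 0` and any `a`: the number of reduced words `w` of length `n` with at least `(ℓ+1)·a`
positions `J` whose window `w[J, J+ℓ]` equals the window at an earlier position is at most
`(ℓ+1) · |F_n| · exp((n/(ℓ+1)) · n(2k−1)^{−(ℓ+1)} · (e^λ − 1) − λ a)`.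
[cite: CalegariWalker2013, Prop. 2.11] -/
theorem card_filter_manyRepeats_le (k n ℓ : ℕ) (hk : 1 ≤ k) {l : ℝ} (hl : 0 ≤ l) (a : ℝ) :
    (((reducedWords k n).filter fun w => ((ℓ : ℝ) + 1) * a ≤
        (((Finset.univ : Finset (Fin (n - ℓ))).filter fun J : Fin (n - ℓ) => ∃ i' : Fin (n - ℓ),
          i' < J ∧ (fun q : Fin (ℓ + 1) => w ⟨i' + q, by omega⟩) =
            fun q : Fin (ℓ + 1) => w ⟨J + q, by omega⟩).card : ℝ)).card : ℝ) ≤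
      ((ℓ : ℝ) + 1) * (reducedWords k n).card *
        Real.exp ((n : ℝ) / ((ℓ : ℝ) + 1) * ((n : ℝ) / (2 * k - 1 : ℝ) ^ (ℓ + 1)) *
          (Real.exp l - 1) - l * a) := by
  refine le_trans ?_ (card_filter_fewDistinctWindows_le k n ℓ hk hl a)
  have hsub : ((reducedWords k n).filter fun w => ((ℓ : ℝ) + 1) * a ≤
      (((Finset.univ : Finset (Fin (n - ℓ))).filter fun J : Fin (n - ℓ) => ∃ i' : Fin (n - ℓ),
        i' < J ∧ (fun q : Fin (ℓ + 1) => w ⟨i' + q, by omega⟩) =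
          fun q : Fin (ℓ + 1) => w ⟨J + q, by omega⟩).card : ℝ)) ⊆
      (reducedWords k n).filter fun w => ((ℓ : ℝ) + 1) * a ≤
        (((n - ℓ : ℕ) : ℝ) - (((Finset.univ : Finset (Fin (n - ℓ))).image fun J : Fin (n - ℓ) =>
          fun q : Fin (ℓ + 1) => w ⟨J + q, by omega⟩).card : ℝ)) := by
    intro w hw
    rw [Finset.mem_filter] at hw ⊢
    refine ⟨hw.1, hw.2.trans ?_⟩
    have h := card_repeats_le_sub_card_image
      (fun J : Fin (n - ℓ) => fun q : Fin (ℓ + 1) => w ⟨J + q, by omega⟩)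
    have h' := (Nat.cast_le (α := ℝ)).mpr h
    refine h'.trans ?_
    have hle : (Finset.univ.image fun J : Fin (n - ℓ) => fun q : Fin (ℓ + 1) =>
        w ⟨J + q, by omega⟩).card ≤ n - ℓ := by
      have := Finset.card_image_le (s := (Finset.univ : Finset (Fin (n - ℓ))))
        (f := fun J : Fin (n - ℓ) => fun q : Fin (ℓ + 1) => w ⟨J + q, by omega⟩)
      simpa using this
    rw [Nat.cast_sub hle]
  exact (Nat.cast_le (α := ℝ)).mpr (Finset.card_le_card hsub)

end DistinctWindows

end Literature.GroupTheory.CombinatorialGroupTheory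

end
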